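import Summits.AtomisticToContinuum.BoseEinsteinCondensation.Theorems.BECCutLineWeakDisorderWitnessTransferBlumenthal
import Literature.MathematicalPhysics.QuantumManyBody.GroundStateFeynmanKac
import Mathlib.MeasureTheory.Function.StronglyMeasurable.Basic
import HarnessLib

/-!
# Route BECCutLineWeakDisorder — crux `WitnessTransfer`, line `Sketch`: zero-one upgrade for the pair action

Shared last step of stubs (S6) and (S9): if for some `p > 0` and all small `t > 0` the pair
action `A_t = ∫₀ᵗ v(|Bⁱ_s − Bʲ_s|) ds` is infinite with probability `≥ p`, then `A_T = ∞` a.s.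
for every `T > 0`. Indeed `E = ⋂ₙ {A_{T₀/(n+1)} = ∞}` is a germ event of the `3N` coordinates
(for `t ≤ s`, `A_t` is a measurable functional of the past up to `s`: the clamped coordinate
process `r ↦ b_{r ∧ s}` is continuous in `r` and past-measurable for each `r`, hence jointly
measurable), so Blumenthal's zero-one law (`stub_wienerPaths_zero_or_one_of_germ`) and
`P(E) = infₙ P(A_{tₙ} = ∞) ≥ p` give `P(E) = 1`, and `E ⊆ {A_T = ∞}`.
-/

noncomputable section

open MeasureTheory ProbabilityTheory Filter Set Metric
open scoped ENNReal NNReal Topology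

namespace Summit.AtomisticToContinuum.BoseEinsteinCondensation.Theorems.CutLineWitness

open Literature.MathematicalPhysics.QuantumManyBody.BoseGas
open Literature.Probability.Process

/-! ### Past-measurability of the pair action -/

/-- The clamped pair distance `r ↦ |y + √2 (b_{r∧s}(ω i ·) − b_{r∧s}(ω j ·))|` is jointly
measurable in `(r, ω)` for the past σ-algebra `σ(b_u(ω m l) : u ≤ s)` on `ω` (continuous in
`r`, past-measurable for each `r`). [folklore] -/
theorem measurable_uncurry_clampedPairNorm {N : ℕ} (y : Space) (i j : Fin N) (s : ℝ≥0) :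
    Measurable[@Prod.instMeasurableSpace ℝ (PathSpace N) _ (MeasurableSpace.comap
      (fun (ω : PathSpace N) (i : Fin N) (k : Fin 3) (u : Set.Iic s) => brownian u (ω i k))
      inferInstance)]
      (Function.uncurry fun (r : ℝ) (ω : PathSpace N) =>
        ‖y + WithLp.toLp 2 (fun l => Real.sqrt 2 *
          (brownian (min r.toNNReal s) (ω i l) - brownian (min r.toNNReal s) (ω j l)))‖) := by
  set mP : MeasurableSpace (PathSpace N) := MeasurableSpace.comap (fun (ω : PathSpace N)
    (i : Fin N) (k : Fin 3) (u : Set.Iic s) => brownian u (ω i k)) inferInstance with hmP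
  -- each clamped coordinate is past-measurable
  have hb : ∀ (m : Fin N) (l : Fin 3) (r : ℝ),
      Measurable[mP] fun ω : PathSpace N => brownian (min r.toNNReal s) (ω m l) := by
    intro m l r
    have h : (fun ω : PathSpace N => brownian (min r.toNNReal s) (ω m l)) =
        (fun π : Fin N → Fin 3 → Set.Iic s → ℝ => π m l ⟨min r.toNNReal s, Set.mem_Iic.2 (min_le_right _ _)⟩) ∘
          fun (ω : PathSpace N) (i : Fin N) (k : Fin 3) (u : Set.Iic s) => brownian u (ω i k) := rfl
    rw [h]
    exact ((measurable_pi_apply _).comp ((measurable_pi_apply l).comp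
      (measurable_pi_apply m))).comp (comap_measurable _)
  have hcont : ∀ ω : PathSpace N, Continuous fun r : ℝ =>
      ‖y + WithLp.toLp 2 (fun l => Real.sqrt 2 *
        (brownian (min r.toNNReal s) (ω i l) - brownian (min r.toNNReal s) (ω j l)))‖ := by
    intro ω
    refine (continuous_const.add ?_).norm
    refine (PiLp.continuous_toLp 2 _).comp ?_
    refine continuous_pi fun l => continuous_const.mul ?_
    have hc : Continuous fun r : ℝ => min r.toNNReal s :=
      continuous_real_toNNReal.min continuous_const
    exact ((continuous_brownian (ω i l)).comp hc).sub ((continuous_brownian (ω j l)).comp hc)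
  have hmeas : ∀ r : ℝ, Measurable[mP] fun ω : PathSpace N =>
      ‖y + WithLp.toLp 2 (fun l => Real.sqrt 2 *
        (brownian (min r.toNNReal s) (ω i l) - brownian (min r.toNNReal s) (ω j l)))‖ := by
    intro r
    refine (measurable_const.add ?_).norm
    refine (PiLp.continuous_toLp 2 _).measurable.comp ?_
    exact measurable_pi_lambda _ fun l => ((hb i l r).sub (hb j l r)).const_mul _
  exact measurable_uncurry_of_continuous_of_measurable (m := mP) hcont hmeas

/-- **The pair action up to time `t ≤ s` is measurable for the past up to `s`.** [folklore] -/
theorem measurable_pairAction_comap_past {N : ℕ} {v : ℝ → ℝ≥0∞} (hv : Measurable v)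
    (X : Config N) (i j : Fin N) {s : ℝ≥0} {t : ℝ} (hts : t ≤ s) :
    Measurable[MeasurableSpace.comap (fun (ω : PathSpace N) (i : Fin N) (k : Fin 3)
      (u : Set.Iic s) => brownian u (ω i k)) inferInstance]
      fun ω : PathSpace N => ∫⁻ r in Set.Ioc 0 t,
        v (dist (worldLine X ω r.toNNReal i) (worldLine X ω r.toNNReal j)) := by
  let mP : MeasurableSpace (PathSpace N) := MeasurableSpace.comap (fun (ω : PathSpace N)
    (i : Fin N) (k : Fin 3) (u : Set.Iic s) => brownian u (ω i k)) inferInstance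
  -- the clamped integrand `(ω, r) ↦ v |y + √2 d_{r ∧ s}|` is measurable for `mP ⊗ 𝓑(ℝ)`
  have hDm := measurable_uncurry_clampedPairNorm (N := N) (X i - X j) i j s
  have hF : Measurable[@Prod.instMeasurableSpace ℝ (PathSpace N) _ mP]
      (Function.uncurry fun (r : ℝ) (ω : PathSpace N) =>
        v ‖(X i - X j) + WithLp.toLp 2 (fun l => Real.sqrt 2 *
          (brownian (min r.toNNReal s) (ω i l) - brownian (min r.toNNReal s) (ω j l)))‖) :=
    hv.comp hDm
  have hI := @Measurable.lintegral_prod_left ℝ (PathSpace N) _ mP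
    (volume.restrict (Set.Ioc 0 t)) _ _ hF
  -- on `(0, t]`, `t ≤ s`, the clamp is inactive
  have hEq : (fun ω : PathSpace N => ∫⁻ r in Set.Ioc 0 t,
      v (dist (worldLine X ω r.toNNReal i) (worldLine X ω r.toNNReal j))) =
      fun ω : PathSpace N => ∫⁻ r in Set.Ioc 0 t, v ‖(X i - X j) + WithLp.toLp 2 (fun l => Real.sqrt 2 *
        (brownian (min r.toNNReal s) (ω i l) - brownian (min r.toNNReal s) (ω j l)))‖ := by
    funext ω
    refine setLIntegral_congr_fun measurableSet_Ioc fun r hr => ?_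
    have hmin : min r.toNNReal s = r.toNNReal :=
      min_eq_left (by
        rw [← NNReal.coe_le_coe, Real.coe_toNNReal _ hr.1.le]
        exact hr.2.trans hts)
    simp only [hmin]
    rw [dist_eq_norm]
    congr 2
    unfold worldLine
    ext l
    simp only [PiLp.sub_apply, PiLp.add_apply]
    ring
  rw [hEq]
  exact hI

/-- The pair action is measurable. [folklore] -/
theorem measurable_pairAction {N : ℕ} {v : ℝ → ℝ≥0∞} (hv : Measurable v) (X : Config N)
    (i j : Fin N) (t : ℝ) :
    Measurable fun ω : PathSpace N => ∫⁻ r in Set.Ioc 0 t,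
      v (dist (worldLine X ω r.toNNReal i) (worldLine X ω r.toNNReal j)) := by
  have h := measurable_pairAction_comap_past hv X i j (s := (max t 0).toNNReal) (t := t)
    (by simp [Real.coe_toNNReal _ (le_max_right t 0)])
  exact h.mono ((measurable_pathsPast N _).comap_le) le_rfl

/-! ### The zero-one upgrade -/

/-- **Zero-one upgrade.** If `P(A_t = ∞) ≥ p > 0` for all `t ∈ (0, T₀]`, then `A_T = ∞` a.s. for
every `T > 0` (Blumenthal on the germ event `⋂ₙ {A_{T₀/(n+1)} = ∞}`). [folklore] -/
theorem pairAction_ae_top_of_uniform_pos {N : ℕ} {v : ℝ → ℝ≥0∞} (hv : Measurable v)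
    (X : Config N) (i j : Fin N) {p : ℝ≥0∞} (hp : p ≠ 0) {T₀ : ℝ} (hT₀ : 0 < T₀)
    (hpos : ∀ t ∈ Set.Ioc 0 T₀, p ≤ wienerPaths N {ω | ∫⁻ r in Set.Ioc 0 t,
      v (dist (worldLine X ω r.toNNReal i) (worldLine X ω r.toNNReal j)) = ⊤})
    {T : ℝ} (hT : 0 < T) :
    ∀ᵐ ω ∂wienerPaths N, ∫⁻ r in Set.Ioc 0 T,
      v (dist (worldLine X ω r.toNNReal i) (worldLine X ω r.toNNReal j)) = ⊤ := by
  haveI := Literature.Probability.RandomPlanarGeometry.isProbabilityMeasure_preWienerMeasure'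
  haveI : IsProbabilityMeasure (wienerPaths N) := by
    unfold wienerPaths; infer_instance
  set A : ℝ → PathSpace N → ℝ≥0∞ := fun t ω => ∫⁻ r in Set.Ioc 0 t,
    v (dist (worldLine X ω r.toNNReal i) (worldLine X ω r.toNNReal j)) with hA
  have hAm : ∀ t, Measurable (A t) := fun t => measurable_pairAction hv X i j t
  have hAmono : ∀ {t t'}, t ≤ t' → ∀ ω, A t ω ≤ A t' ω := fun h ω =>
    lintegral_mono_set (Set.Ioc_subset_Ioc_right h)
  -- the times tₙ = T₀/(n+1) and the germ event
  set tn : ℕ → ℝ := fun n => T₀ / ((n : ℝ) + 1) with htn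
  have htn_pos : ∀ n, 0 < tn n := fun n => by rw [htn]; positivity
  have htn_le : ∀ n, tn n ≤ T₀ := fun n => by
    rw [htn]; exact div_le_self hT₀.le (by linarith [(Nat.cast_nonneg n : (0:ℝ) ≤ n)])
  have htn_anti : ∀ {m n}, m ≤ n → tn n ≤ tn m := fun {m n} hmn => by
    simp only [htn]
    exact div_le_div_of_nonneg_left hT₀.le (by positivity) (by exact_mod_cast Nat.add_le_add_right hmn 1)
  have htn_small : ∀ ε : ℝ, 0 < ε → ∃ n, tn n ≤ ε := by
    intro ε hε
    obtain ⟨n, hn⟩ := exists_nat_gt (T₀ / ε)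
    refine ⟨n, ?_⟩
    rw [htn, div_le_iff₀ (by positivity)]
    rw [div_lt_iff₀ hε] at hn
    nlinarith
  set E : Set (PathSpace N) := ⋂ n, {ω | A (tn n) ω = ⊤} with hE
  have hEn : ∀ n, MeasurableSet {ω | A (tn n) ω = ⊤} := fun n =>
    hAm _ (measurableSet_singleton _)
  -- germ property
  have hgerm : ∀ s : ℝ≥0, 0 < s → ∃ E' : Set (PathSpace N),
      MeasurableSet[MeasurableSpace.comap (fun (ω : PathSpace N) (i : Fin N) (k : Fin 3)
        (u : Set.Iic s) => brownian u (ω i k)) inferInstance] E' ∧ E =ᵐ[wienerPaths N] E' := by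
    intro s hs
    obtain ⟨n₀, hn₀⟩ := htn_small s (by exact_mod_cast hs)
    refine ⟨⋂ n, ⋂ (_ : n₀ ≤ n), {ω | A (tn n) ω = ⊤}, ?_, ?_⟩
    · refine MeasurableSet.iInter fun n => MeasurableSet.iInter fun hn => ?_
      exact measurable_pairAction_comap_past hv X i j ((htn_anti hn).trans hn₀)
        (measurableSet_singleton _)
    · refine Filter.EventuallyEq.of_eq (Set.ext fun ω => ⟨fun hω => ?_, fun hω => ?_⟩)
      · simp only [hE, Set.mem_iInter, Set.mem_setOf_eq] at hω ⊢
        exact fun n _ => hω n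
      · simp only [hE, Set.mem_iInter, Set.mem_setOf_eq] at hω ⊢
        intro n
        rcases le_or_gt n₀ n with h | h
        · exact hω n h
        · exact eq_top_iff.2 ((hω n₀ le_rfl) ▸ hAmono (htn_anti h.le) ω)
  have h01 := stub_wienerPaths_zero_or_one_of_germ hgerm
  -- P(E) = inf P(A_{tₙ} = ⊤) ≥ p
  have hPE : wienerPaths N E = ⨅ n, wienerPaths N {ω | A (tn n) ω = ⊤} := by
    rw [hE]
    refine Antitone.measure_iInter (fun m n hmn ω hω => ?_) (fun n => (hEn n).nullMeasurableSet)
      ⟨0, measure_ne_top _ _⟩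
    exact eq_top_iff.2 ((show A (tn n) ω = ⊤ from hω) ▸ hAmono (htn_anti hmn) ω)
  have hPE_pos : p ≤ wienerPaths N E := by
    rw [hPE]
    exact le_iInf fun n => hpos (tn n) ⟨htn_pos n, htn_le n⟩
  have hPE1 : wienerPaths N E = 1 := by
    rcases h01 with h | h
    · exact absurd (le_antisymm (hPE_pos.trans h.le) bot_le) hp
    · exact h
  -- conclude at time T
  obtain ⟨n, hn⟩ := htn_small T hT
  have hsub : E ⊆ {ω | A T ω = ⊤} := fun ω hω =>
    eq_top_iff.2 ((Set.mem_iInter.1 hω n) ▸ hAmono hn ω)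
  have hT1 : wienerPaths N {ω | A T ω = ⊤} = 1 :=
    le_antisymm prob_le_one (hPE1 ▸ measure_mono hsub)
  change ∀ᵐ ω ∂wienerPaths N, A T ω = ⊤
  have hc : wienerPaths N {ω | A T ω = ⊤}ᶜ = 0 := by
    have hm : MeasurableSet {ω | A T ω = ⊤} := hAm T (measurableSet_singleton _)
    rw [measure_compl hm (measure_ne_top _ _), hT1, measure_univ, tsub_self]
  rw [ae_iff]
  simpa [Set.compl_setOf] using hc

end Summit.AtomisticToContinuum.BoseEinsteinCondensation.Theorems.CutLineWitness

end
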